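import Mathlib
import Literature.AlgebraicGeometry.Resolution.CobordantGame
import Summits.ResolutionOfSingularities.ResolutionOfSingularities.Theorems.WeightedInvariantLocalWeightedDropGradedSliceRank

/-!
# `WeightedInvariant.LocalWeightedDrop`: the Frobenius line `x_{i₁}^p + x_{i₂}^p` is graded-won with rank `1` — so a wild
# grading costs it EXACTLY one move (every dimension, every lattice)

Route `ResolutionOfSingularities/WeightedInvariant`, crux `LocalWeightedDrop` (stmt-ResolutionOfSingularities-8899).
[OURS · L1 W4.3] — CHAIN w43 SEAT TABLE v7 row res-type-060 «idea-1's graded slices»; class-level companion of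
`…GradedFrobeniusLineObstruction` (p510080: `not_gradedWonBy_zero_X_pow_add_X_pow`, no graded ONE-move win when the characters of
`x_{i₁}`, `x_{i₂}` differ) and of the `n = 3` slice files `…GradedSliceRank` (p507692), `…GradedSliceNoOneMoveWin` (p508918),
`…GradedSliceRankOne` (p509095).  A calibration theorem for the graded game `GradedGame.GradedWonBy` of the line (idea-1 Sketch
v3/v4 §5).  Nothing here is a statement of the manuscript under review on ladder RESOLUTION; not a verdict on card A.  AI proof,
weaker than expert review.

* `gradedWonBy_one_X_pow_add_X_pow` — for every field of characteristic `p`, every `n`, every lattice `L ⊆ ℤⁿ` and `i₁ ≠ i₂`: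
  `GradedWonBy 1 n L (x_{i₁}^p + x_{i₂}^p)`.  First move: identity coordinates, centre `{x_{i₁} = x_{i₂} = 0}` (graded for
  every lattice); singular successors only where `c_{i₁}^p + c_{i₂}^p = 0`, hence `c_{i₁} c_{i₂} ≠ 0`, and there the successor is
  `y_{i₁}^p + y_{i₂}^p` with BOTH translated coordinates of trivial character (`e_{y_{i₁}}, e_{y_{i₂}} ∈ succLattice L w c`); second
  move: `y_{i₁} ↦ y_{i₁} − y_{i₂}` (graded now; determinant `1` by Cramer on `updateRow 1`) and the divisorial weight on `y_{i₁}`: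
  `(y_{i₁} − y_{i₂})^p + y_{i₂}^p = y_{i₁}^p` has no singular successor.  With p510080: when the characters of `x_{i₁}`, `x_{i₂}`
  differ the graded rank is EXACTLY `1`.
* tools `linPart_update_X` (linear part of «identity with one slot replaced» = `updateRow 1`), `det_updateRow_one` (`= r a`, Cramer).
-/

set_option linter.dupNamespace false -- mandated namespace of this single-conjunct summit
set_option autoImplicit false

namespace Summit.ResolutionOfSingularities.ResolutionOfSingularities.Theorems

namespace GradedGame

open MvPowerSeries
open Literature.AlgebraicGeometry.Resolution

variable {k : Type} [Field k]

/-- The linear part of «the identity with slot `a` replaced by `φ`» is the identity matrix with row `a` replaced by the linear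
part of `φ`. [OURS · L1 W4.3] -/
theorem linPart_update_X {n : ℕ} (a : Fin n) (φ : MvPowerSeries (Fin n) k) :
    (Matrix.of fun i j => coeff (Finsupp.single j 1) (Function.update (fun i => (X i : MvPowerSeries (Fin n) k)) a φ i)) =
      Matrix.updateRow (1 : Matrix (Fin n) (Fin n) k) a (fun j => coeff (Finsupp.single j 1) φ) := by
  ext i j
  rw [Matrix.of_apply]
  by_cases hi : i = a
  · subst hi
    rw [Function.update_self, Matrix.updateRow_self]
  · rw [Function.update_of_ne hi, Matrix.updateRow_ne hi, coeff_X, Matrix.one_apply]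
    by_cases hij : i = j
    · subst hij; simp
    · rw [if_neg (fun hh => hij ((Finsupp.single_left_inj one_ne_zero).mp hh).symm), if_neg hij]

/-- `det (updateRow 1 a r) = r a` (Cramer). [OURS · L1 W4.3] -/
theorem det_updateRow_one {n : ℕ} (a : Fin n) (r : Fin n → k) :
    (Matrix.updateRow (1 : Matrix (Fin n) (Fin n) k) a r).det = r a := by
  rw [← Matrix.det_transpose, ← Matrix.updateCol_transpose, Matrix.transpose_one, ← Matrix.cramer_apply, Matrix.cramer_one]
  rfl

section FrobeniusLineRankOne

variable (p : ℕ) [hp : Fact p.Prime]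

/-- **THE FROBENIUS LINE IS GRADED-WON WITH RANK `1`** (class level: every dimension `n`, every grading lattice `L ⊆ ℤⁿ`, every
field of characteristic `p`, `i₁ ≠ i₂`): `GradedWonBy 1 n L (x_{i₁}^p + x_{i₂}^p)`.  First move: the identity coordinate change with
centre `{x_{i₁} = x_{i₂} = 0}` (weights `1` on `i₁, i₂`, `0` elsewhere; graded for every lattice); its singular successors sit at the
exceptional points with `c_{i₁}^p + c_{i₂}^p = 0`, hence `c_{i₁} c_{i₂} ≠ 0`, and equal `y_{i₁}^p + y_{i₂}^p` — where now BOTH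
translated coordinates have trivial character (`e_{y_{i₁}}, e_{y_{i₂}} ∈ succLattice L w c`).  Second move: the coordinate change
`y_{i₁} ↦ y_{i₁} − y_{i₂}` IS graded there, `(y_{i₁} − y_{i₂})^p + y_{i₂}^p = y_{i₁}^p`, and the divisorial move on `y_{i₁}` has no
singular successor (`(c + y)^p` has constant term `c^p ≠ 0`).  With `not_gradedWonBy_zero_X_pow_add_X_pow`: when the characters of
`x_{i₁}`, `x_{i₂}` differ, the graded rank of `x_{i₁}^p + x_{i₂}^p` is EXACTLY `1` — a wild grading costs the Frobenius line exactly
one move. [OURS · L1 W4.3] -/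
theorem gradedWonBy_one_X_pow_add_X_pow [CharP k p] {n : ℕ} (L : AddSubgroup (Fin n → ℤ)) (i₁ i₂ : Fin n) (hne : i₁ ≠ i₂) :
    GradedWonBy 1 n L (X i₁ ^ p + X i₂ ^ p : MvPowerSeries (Fin n) k) := by
  classical
  have hp0 : 0 < p := hp.out.pos
  haveI : CharP (MvPowerSeries (Fin (n + 1)) k) p := charP_of_injective_ringHom MvPowerSeries.C_injective p
  haveI : CharP (MvPowerSeries (Fin (n + 1 + 1)) k) p := charP_of_injective_ringHom MvPowerSeries.C_injective p
  rw [gradedWonBy_iff]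
  -- first move: identity, weights `1` on `i₁`, `i₂`
  set w : Fin n → ℕ := fun i => if i = i₁ ∨ i = i₂ then 1 else 0 with hw
  have hw1 : w i₁ = 1 := by simp [hw]
  have hw2 : w i₂ = 1 := by simp [hw]
  refine ⟨fun i => X i, w, isLGradedMove_X L w ⟨i₁, by rw [hw1]; exact one_pos⟩, ?_⟩
  rintro c a g ⟨⟨i, hwi, hci⟩, hfac, hndvd, hc0, -⟩
  refine ⟨0, zero_lt_one, ?_⟩
  have hi12 : i = i₁ ∨ i = i₂ := by
    by_contra hcon
    have : w i = 0 := by simp only [hw]; rw [if_neg hcon]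
    omega
  -- the successor: `σ^p · G`, `G = (c₁ + y₁)^p + (c₂ + y₂)^p`
  set a₁ : Fin (n + 1) := i₁.succ with ha₁
  set a₂ : Fin (n + 1) := i₂.succ with ha₂
  have ha12 : a₁ ≠ a₂ := fun h => hne (Fin.succ_injective _ h)
  have hC := hasSubst_cruxChart (k := k) w c
  set G : MvPowerSeries (Fin (n + 1)) k := (C (c i₁) + X a₁) ^ p + (C (c i₂) + X a₂) ^ p with hG
  have hself : subst (fun i : Fin n => (X i : MvPowerSeries (Fin n) k)) (X i₁ ^ p + X i₂ ^ p : MvPowerSeries (Fin n) k) =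
      (X i₁ ^ p + X i₂ ^ p : MvPowerSeries (Fin n) k) := by
    rw [show (fun i : Fin n => (X i : MvPowerSeries (Fin n) k)) = X from rfl, subst_self]; rfl
  have hchart : subst (CobordantGame.cruxChart k w c) (subst (fun i : Fin n => (X i : MvPowerSeries (Fin n) k))
      (X i₁ ^ p + X i₂ ^ p : MvPowerSeries (Fin n) k)) = X 0 ^ p * G := by
    rw [hself, subst_add hC, subst_pow hC, subst_pow hC, subst_X hC, subst_X hC,
      cruxChart_of_pos w c i₁ (by rw [hw1]; exact one_pos), cruxChart_of_pos w c i₂ (by rw [hw2]; exact one_pos), hw1, hw2,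
      pow_one, mul_pow, mul_pow, hG, mul_add]
  rw [hchart] at hfac
  have hGexp : G = C (c i₁ ^ p + c i₂ ^ p) + (monomial (Finsupp.single a₁ p) 1 + monomial (Finsupp.single a₂ p) 1) := by
    rw [hG, add_pow_char, add_pow_char, ← map_pow, ← map_pow, X_pow_eq, X_pow_eq, map_add]
    ring
  have h10 : (Finsupp.single a₁ p : Fin (n + 1) →₀ ℕ) ≠ 0 := by simp [hp0.ne']
  have h12 : (Finsupp.single a₁ p : Fin (n + 1) →₀ ℕ) ≠ Finsupp.single a₂ p := by
    simp [Finsupp.single_eq_single_iff, hp0.ne', ha12]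
  have hG1 : coeff (Finsupp.single a₁ p) G = 1 := by
    rw [hGexp]
    simp only [map_add, coeff_C, coeff_monomial, h10, h12, if_false, if_true]
    ring
  have hG0 : constantCoeff G = c i₁ ^ p + c i₂ ^ p := by
    simp [hG, map_add, map_pow, constantCoeff_X, constantCoeff_C]
  have hGnd : ¬ X 0 ∣ G := by
    rw [X_dvd_iff]
    push Not
    exact ⟨Finsupp.single a₁ p, by simp [ha₁, Fin.succ_ne_zero], by rw [hG1]; exact one_ne_zero⟩
  obtain ⟨-, hGg⟩ := eq_of_X_pow_mul_eq hfac hGnd hndvd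
  rw [← hGg, hG0] at hc0
  have hc1ne : c i₁ ≠ 0 := by
    intro h1
    rw [h1, zero_pow hp0.ne', zero_add] at hc0
    have h2 : c i₂ = 0 := (pow_eq_zero_iff hp0.ne').mp hc0
    rcases hi12 with rfl | rfl
    · exact hci h1
    · exact hci h2
  have hc2ne : c i₂ ≠ 0 := by
    intro h2
    rw [h2, zero_pow hp0.ne', add_zero] at hc0
    have h1 : c i₁ = 0 := (pow_eq_zero_iff hp0.ne').mp hc0
    rcases hi12 with rfl | rfl
    · exact hci h1
    · exact hci h2
  have hg : g = X a₁ ^ p + X a₂ ^ p := by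
    rw [← hGg, hGexp, hc0, map_zero, zero_add, X_pow_eq, X_pow_eq]
  -- both translated coordinates have trivial character in the propagated lattice
  have he1 : (Pi.single a₁ 1 : Fin (n + 1) → ℤ) ∈ succLattice L w c :=
    AddSubgroup.subset_closure (Or.inr ⟨i₁, hc1ne, by rw [hw1]; exact one_pos, rfl⟩)
  have he2 : (Pi.single a₂ 1 : Fin (n + 1) → ℤ) ∈ succLattice L w c :=
    AddSubgroup.subset_closure (Or.inr ⟨i₂, hc2ne, by rw [hw2]; exact one_pos, rfl⟩)
  -- second move: `y₁ ↦ y₁ − y₂`, divisorial weight on `y₁`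
  rw [gradedWonBy_zero_iff]
  set θ'' : Fin (n + 1) → MvPowerSeries (Fin (n + 1)) k :=
    Function.update (fun i => (X i : MvPowerSeries (Fin (n + 1)) k)) a₁ (X a₁ - X a₂) with hθ''
  have hθa : θ'' a₁ = X a₁ - X a₂ := by simp [hθ'']
  have hθi : ∀ i, i ≠ a₁ → θ'' i = X i := by intro i hi; simp [hθ'', hi]
  have hθc : ∀ j, constantCoeff (θ'' j) = 0 := by
    intro j
    by_cases hj : j = a₁
    · rw [hj, hθa, map_sub, constantCoeff_X, constantCoeff_X, sub_zero]
    · rw [hθi j hj]; exact constantCoeff_X j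
  have hθs : HasSubst θ'' := hasSubst_of_constantCoeff_zero hθc
  set w'' : Fin (n + 1) → ℕ := fun i => if i = a₁ then 1 else 0 with hw''
  have hw''1 : w'' a₁ = 1 := by simp [hw'']
  refine ⟨θ'', w'', ⟨⟨hθc, ?_, ⟨a₁, by rw [hw''1]; exact one_pos⟩⟩, ?_⟩, ?_⟩
  · -- determinant `= 1`
    rw [hθ'', linPart_update_X, det_updateRow_one, map_sub, coeff_X, coeff_X, if_pos rfl,
      if_neg (fun hh => ha12 ((Finsupp.single_left_inj one_ne_zero).mp hh))]
    simp
  · -- gradedness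
    intro j e he
    by_cases hj : j = a₁
    · subst hj
      rw [hθa, map_sub, coeff_X, coeff_X] at he
      by_cases hE1 : e = Finsupp.single a₁ 1
      · subst hE1
        rw [expVec_single, Nat.cast_one, sub_self]
        exact AddSubgroup.zero_mem _
      · by_cases hE2 : e = Finsupp.single a₂ 1
        · subst hE2
          rw [expVec_single, Nat.cast_one]
          exact AddSubgroup.sub_mem _ he2 he1
        · exact absurd (by rw [if_neg hE1, if_neg hE2, sub_zero]) he
    · have hej : e = Finsupp.single j 1 := by
        rw [hθi j hj, coeff_X] at he
        by_contra hne'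
        exact he (if_neg hne')
      subst hej
      rw [expVec_single, Nat.cast_one, sub_self]
      exact AddSubgroup.zero_mem _
  · -- no singular successor
    rintro c' a' g' ⟨⟨i', hwi', hci'⟩, hfac', hndvd', hc0', -⟩
    have hi' : i' = a₁ := by
      by_contra hcon
      have : w'' i' = 0 := by simp only [hw'']; rw [if_neg hcon]
      omega
    have hC' := hasSubst_cruxChart (k := k) w'' c'
    have hsub' : subst θ'' g = X a₁ ^ p := by
      rw [hg, subst_add hθs, subst_pow hθs, subst_pow hθs, subst_X hθs, subst_X hθs, hθa, hθi a₂ ha12.symm, sub_pow_char]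
      ring
    rw [hsub', subst_pow hC', subst_X hC', cruxChart_of_pos w'' c' a₁ (by rw [hw''1]; exact one_pos), hw''1, pow_one,
      mul_pow] at hfac'
    set G' : MvPowerSeries (Fin (n + 1 + 1)) k := (C (c' a₁) + X a₁.succ) ^ p with hG'
    have hG'exp : G' = C (c' a₁ ^ p) + monomial (Finsupp.single a₁.succ p) 1 := by
      rw [hG', add_pow_char, ← map_pow, X_pow_eq]
    have h30 : (Finsupp.single a₁.succ p : Fin (n + 1 + 1) →₀ ℕ) ≠ 0 := by simp [hp0.ne']
    have hG'3 : coeff (Finsupp.single a₁.succ p) G' = 1 := by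
      rw [hG'exp, map_add, coeff_C, coeff_monomial, if_neg h30, if_pos rfl, zero_add]
    have hG'nd : ¬ X 0 ∣ G' := by
      rw [X_dvd_iff]
      push Not
      exact ⟨Finsupp.single a₁.succ p, by simp [Fin.succ_ne_zero], by rw [hG'3]; exact one_ne_zero⟩
    obtain ⟨-, hGg'⟩ := eq_of_X_pow_mul_eq hfac' hG'nd hndvd'
    rw [← hGg', hG'exp, map_add, constantCoeff_C] at hc0'
    have hmono : constantCoeff (monomial (Finsupp.single a₁.succ p) (1 : k) : MvPowerSeries (Fin (n + 1 + 1)) k) = 0 := by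
      rw [← coeff_zero_eq_constantCoeff_apply, coeff_monomial, if_neg h30.symm]
    rw [hmono, add_zero] at hc0'
    have hc'z : c' a₁ = 0 := (pow_eq_zero_iff hp0.ne').mp hc0'
    rw [hi'] at hci'
    exact hci' hc'z

end FrobeniusLineRankOne

end GradedGame

end Summit.ResolutionOfSingularities.ResolutionOfSingularities.Theorems
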